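import Mathlib
import HarnessLib
import Summits.HubbardSuperconductivity.HubbardSuperconductivity.Theorems.KLProgrammeKLRegimeVolumeLimitDefs

/-!
# Child 5 `KLRegimeVolumeLimitV7` (stmt-HubbardSuperconductivity-19665) — the ALGEBRA of the volume-limit clauses (model-free):
# sums, multiplication by a grid-exact bounded continuous dressing, grid-exact families (seat hubbard-kl-k3c5-p2)

The three clauses of the VL text `FinalTwoLegVolLimit` (`…KLRegimeVolumeLimitDefs`) — (1) a momentum-continuous limit per Matsubara integer, (2) a bound
uniform in the volume beyond `(L₀, Mstar)`, (3) grid convergence eventually in `L` then in `M`, uniformly on the momentum grid — are stated here for an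
ABSTRACT volume-indexed grid family `S L M : FreqMomentum L M → Fin 2 → ℂ` (the shape of k3c4-p1's `volLimit_of_termwise`) and shown to be closed under
the operations every rung of child 5 is built from:

* `volLimitShape_add` — `S + T`;
* `volLimitShape_dressing_mul` — `Φ · S` for a DRESSING `Φ L M (ω, k⃗) = φ (matsubaraInt ω) (p_{k⃗})` read EXACTLY on the grid from a family `φ n` of
  continuous functions bounded by `Bφ` (the frame factors `(ĝ₀/ĝ_K)^j`, `(ĝ_{K'}/ĝ_K)²`, `K(p)`, constants);
* `volLimitShape_of_gridExact` — such a dressing alone satisfies the clauses with limit `φ` and grid error `0`.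

These are the patterns inside `…VolumeLimitZeroCoupling` (U⁰), `…VolumeLimitHartreeLimit` (U¹) and `…VolumeLimitFrameCovariance` (frame transfer),
abstracted for the higher rungs (U²: `(ĝ₀/ĝ_K)² · [sunset + one-loop²]`, k3c5-p3) and for the engine's termwise assembly.  Pure bookkeeping; no definition.
-/

noncomputable section

namespace Summit.HubbardSuperconductivity.HubbardSuperconductivity.Theorems.KLRegimeSplit

set_option linter.dupNamespace false -- summit = problem name (single-conjunct summit), D-0017

open Filter Topology Finset Literature.MathematicalPhysics.QuantumLattice Literature.Probability.LatticeModels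

/-- **Sum rule.**  If `S` and `T` satisfy the VL clauses with data `(Σ∞, B, L₀)` and `(Σ∞', B', L₀')` (same `Mstar`), then `S + T` satisfies them with
`(Σ∞ + Σ∞', B + B', max L₀ L₀')`. -/
theorem volLimitShape_add
    {S T : ∀ (L M : ℕ) [NeZero L] [NeZero M], FreqMomentum L M → Fin 2 → ℂ} {Mstar : ℕ → ℕ}
    {sigS sigT : ℤ → (Fin 2 → ℝ) → Fin 2 → ℂ} {BS BT : ℝ} {LS LT : ℕ}
    (hcS : ∀ (n : ℤ) (σ : Fin 2), Continuous fun p : Fin 2 → ℝ => sigS n p σ)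
    (hbS : ∀ (L : ℕ) [NeZero L], LS ≤ L → ∀ (M : ℕ) [NeZero M], Mstar L ≤ M → ∀ (k : FreqMomentum L M) (σ : Fin 2), ‖S L M k σ‖ ≤ BS)
    (hlS : ∀ (n : ℤ) (σ : Fin 2) (ε : ℝ), 0 < ε → ∃ L₁ : ℕ, ∀ (L : ℕ) [NeZero L], L₁ ≤ L →
      ∃ M₁ : ℕ, ∀ (M : ℕ) [NeZero M], M₁ ≤ M → ∀ ω : MatsubaraIdx M, matsubaraInt M ω = n →
        ∀ k : TorusSite 2 L, ‖S L M (ω, k) σ - sigS n (latticeMomentum L k) σ‖ ≤ ε)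
    (hcT : ∀ (n : ℤ) (σ : Fin 2), Continuous fun p : Fin 2 → ℝ => sigT n p σ)
    (hbT : ∀ (L : ℕ) [NeZero L], LT ≤ L → ∀ (M : ℕ) [NeZero M], Mstar L ≤ M → ∀ (k : FreqMomentum L M) (σ : Fin 2), ‖T L M k σ‖ ≤ BT)
    (hlT : ∀ (n : ℤ) (σ : Fin 2) (ε : ℝ), 0 < ε → ∃ L₁ : ℕ, ∀ (L : ℕ) [NeZero L], L₁ ≤ L →
      ∃ M₁ : ℕ, ∀ (M : ℕ) [NeZero M], M₁ ≤ M → ∀ ω : MatsubaraIdx M, matsubaraInt M ω = n →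
        ∀ k : TorusSite 2 L, ‖T L M (ω, k) σ - sigT n (latticeMomentum L k) σ‖ ≤ ε) :
    (∀ (n : ℤ) (σ : Fin 2), Continuous fun p : Fin 2 → ℝ => sigS n p σ + sigT n p σ) ∧
    (∀ (L : ℕ) [NeZero L], max LS LT ≤ L → ∀ (M : ℕ) [NeZero M], Mstar L ≤ M →
      ∀ (k : FreqMomentum L M) (σ : Fin 2), ‖S L M k σ + T L M k σ‖ ≤ BS + BT) ∧
    (∀ (n : ℤ) (σ : Fin 2) (ε : ℝ), 0 < ε → ∃ L₁ : ℕ, ∀ (L : ℕ) [NeZero L], L₁ ≤ L →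
      ∃ M₁ : ℕ, ∀ (M : ℕ) [NeZero M], M₁ ≤ M → ∀ ω : MatsubaraIdx M, matsubaraInt M ω = n →
        ∀ k : TorusSite 2 L,
          ‖(S L M (ω, k) σ + T L M (ω, k) σ) - (sigS n (latticeMomentum L k) σ + sigT n (latticeMomentum L k) σ)‖ ≤ ε) := by
  refine ⟨fun n σ => (hcS n σ).add (hcT n σ), ?_, ?_⟩
  · intro L _ hL M _ hM k σ
    exact (norm_add_le _ _).trans (add_le_add (hbS L (le_trans (le_max_left _ _) hL) M hM k σ)
      (hbT L (le_trans (le_max_right _ _) hL) M hM k σ))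
  · intro n σ ε hε
    obtain ⟨L₁, hL₁⟩ := hlS n σ (ε / 2) (half_pos hε)
    obtain ⟨L₂, hL₂⟩ := hlT n σ (ε / 2) (half_pos hε)
    refine ⟨max L₁ L₂, fun L _ hL => ?_⟩
    obtain ⟨M₁, hM₁⟩ := hL₁ L (le_trans (le_max_left _ _) hL)
    obtain ⟨M₂, hM₂⟩ := hL₂ L (le_trans (le_max_right _ _) hL)
    refine ⟨max M₁ M₂, fun M _ hM ω hω k => ?_⟩
    have h1 := hM₁ M (le_trans (le_max_left _ _) hM) ω hω k
    have h2 := hM₂ M (le_trans (le_max_right _ _) hM) ω hω k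
    calc ‖(S L M (ω, k) σ + T L M (ω, k) σ) - (sigS n (latticeMomentum L k) σ + sigT n (latticeMomentum L k) σ)‖
        = ‖(S L M (ω, k) σ - sigS n (latticeMomentum L k) σ) + (T L M (ω, k) σ - sigT n (latticeMomentum L k) σ)‖ := by
          congr 1; ring
      _ ≤ ε / 2 + ε / 2 := (norm_add_le _ _).trans (add_le_add h1 h2)
      _ = ε := by ring

/-- **A grid-exact dressing satisfies the clauses** (limit `φ`, bound `Bφ`, threshold `0`, grid error `0`). -/
theorem volLimitShape_of_gridExact
    {Φ : ∀ (L M : ℕ) [NeZero L] [NeZero M], FreqMomentum L M → ℂ} (Mstar : ℕ → ℕ) {φ : ℤ → (Fin 2 → ℝ) → ℂ} {Bφ : ℝ}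
    (hφc : ∀ n : ℤ, Continuous (φ n)) (hφb : ∀ (n : ℤ) (p : Fin 2 → ℝ), ‖φ n p‖ ≤ Bφ)
    (hΦ : ∀ (L M : ℕ) [NeZero L] [NeZero M] (ω : MatsubaraIdx M) (k : TorusSite 2 L),
      Φ L M (ω, k) = φ (matsubaraInt M ω) (latticeMomentum L k)) :
    (∀ (n : ℤ) (_σ : Fin 2), Continuous fun p : Fin 2 → ℝ => φ n p) ∧
    (∀ (L : ℕ) [NeZero L], 0 ≤ L → ∀ (M : ℕ) [NeZero M], Mstar L ≤ M →
      ∀ (k : FreqMomentum L M) (_σ : Fin 2), ‖Φ L M k‖ ≤ Bφ) ∧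
    (∀ (n : ℤ) (_σ : Fin 2) (ε : ℝ), 0 < ε → ∃ L₁ : ℕ, ∀ (L : ℕ) [NeZero L], L₁ ≤ L →
      ∃ M₁ : ℕ, ∀ (M : ℕ) [NeZero M], M₁ ≤ M → ∀ ω : MatsubaraIdx M, matsubaraInt M ω = n →
        ∀ k : TorusSite 2 L, ‖Φ L M (ω, k) - φ n (latticeMomentum L k)‖ ≤ ε) := by
  refine ⟨fun n _ => hφc n, ?_, ?_⟩
  · intro L _ _ M _ _ k σ
    obtain ⟨ω, kv⟩ := k
    rw [hΦ]
    exact hφb _ _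
  · intro n σ ε hε
    refine ⟨0, fun L _ _ => ⟨0, fun M _ _ ω hω k => ?_⟩⟩
    rw [hΦ, hω, sub_self, norm_zero]
    exact hε.le

/-- **Dressing rule.**  If `S` satisfies the VL clauses with data `(Σ∞, B, L₀)` and `Φ` is a grid-exact dressing read from continuous `φ n` bounded by
`Bφ ≥ 0`, then `Φ · S` satisfies them with `(φ · Σ∞, Bφ · B, L₀)` (constants: `φ ≡ c`). -/
theorem volLimitShape_dressing_mul
    {S : ∀ (L M : ℕ) [NeZero L] [NeZero M], FreqMomentum L M → Fin 2 → ℂ} {Mstar : ℕ → ℕ}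
    {sigS : ℤ → (Fin 2 → ℝ) → Fin 2 → ℂ} {BS : ℝ} {LS : ℕ}
    {Φ : ∀ (L M : ℕ) [NeZero L] [NeZero M], FreqMomentum L M → ℂ} {φ : ℤ → (Fin 2 → ℝ) → ℂ} {Bφ : ℝ} (hBφ : 0 ≤ Bφ)
    (hφc : ∀ n : ℤ, Continuous (φ n)) (hφb : ∀ (n : ℤ) (p : Fin 2 → ℝ), ‖φ n p‖ ≤ Bφ)
    (hΦ : ∀ (L M : ℕ) [NeZero L] [NeZero M] (ω : MatsubaraIdx M) (k : TorusSite 2 L),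
      Φ L M (ω, k) = φ (matsubaraInt M ω) (latticeMomentum L k))
    (hcS : ∀ (n : ℤ) (σ : Fin 2), Continuous fun p : Fin 2 → ℝ => sigS n p σ)
    (hbS : ∀ (L : ℕ) [NeZero L], LS ≤ L → ∀ (M : ℕ) [NeZero M], Mstar L ≤ M → ∀ (k : FreqMomentum L M) (σ : Fin 2), ‖S L M k σ‖ ≤ BS)
    (hlS : ∀ (n : ℤ) (σ : Fin 2) (ε : ℝ), 0 < ε → ∃ L₁ : ℕ, ∀ (L : ℕ) [NeZero L], L₁ ≤ L →
      ∃ M₁ : ℕ, ∀ (M : ℕ) [NeZero M], M₁ ≤ M → ∀ ω : MatsubaraIdx M, matsubaraInt M ω = n →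
        ∀ k : TorusSite 2 L, ‖S L M (ω, k) σ - sigS n (latticeMomentum L k) σ‖ ≤ ε) :
    (∀ (n : ℤ) (σ : Fin 2), Continuous fun p : Fin 2 → ℝ => φ n p * sigS n p σ) ∧
    (∀ (L : ℕ) [NeZero L], LS ≤ L → ∀ (M : ℕ) [NeZero M], Mstar L ≤ M →
      ∀ (k : FreqMomentum L M) (σ : Fin 2), ‖Φ L M k * S L M k σ‖ ≤ Bφ * BS) ∧
    (∀ (n : ℤ) (σ : Fin 2) (ε : ℝ), 0 < ε → ∃ L₁ : ℕ, ∀ (L : ℕ) [NeZero L], L₁ ≤ L →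
      ∃ M₁ : ℕ, ∀ (M : ℕ) [NeZero M], M₁ ≤ M → ∀ ω : MatsubaraIdx M, matsubaraInt M ω = n →
        ∀ k : TorusSite 2 L,
          ‖Φ L M (ω, k) * S L M (ω, k) σ - φ n (latticeMomentum L k) * sigS n (latticeMomentum L k) σ‖ ≤ ε) := by
  refine ⟨fun n σ => (hφc n).mul (hcS n σ), ?_, ?_⟩
  · intro L _ hL M _ hM k σ
    obtain ⟨ω, kv⟩ := k
    rw [norm_mul, hΦ]
    exact mul_le_mul (hφb _ _) (hbS L hL M hM (ω, kv) σ) (norm_nonneg _) hBφ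
  · intro n σ ε hε
    obtain ⟨L₁, hL₁⟩ := hlS n σ (ε / (Bφ + 1)) (by positivity)
    refine ⟨L₁, fun L _ hL => ?_⟩
    obtain ⟨M₁, hM₁⟩ := hL₁ L hL
    refine ⟨M₁, fun M _ hM ω hω k => ?_⟩
    have h := hM₁ M hM ω hω k
    rw [hΦ, hω, ← mul_sub, norm_mul]
    calc ‖φ n (latticeMomentum L k)‖ * ‖S L M (ω, k) σ - sigS n (latticeMomentum L k) σ‖
        ≤ Bφ * (ε / (Bφ + 1)) := mul_le_mul (hφb _ _) h (norm_nonneg _) hBφ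
      _ ≤ ε := by
          rw [← mul_div_assoc, div_le_iff₀ (by positivity)]
          nlinarith

end Summit.HubbardSuperconductivity.HubbardSuperconductivity.Theorems.KLRegimeSplit

end
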